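import Summits.QuantumFields.YangMills.Theorems.UnitScaleTiltProp7AvgTrueLinearisation
import HarnessLib

/-!
# Route `UnitScaleTilt`, crux K1 child «MinimiserStabilityRegPr» (stmt-QuantumFields-19200), registered stub `stub_prop7From14` (leaf V3 «Prop 7 from a
# background (14)») — WALK MASSES: `(Σ_{s∈Γ}‖Y_s‖)² ≤ |Γ|·Σ_{s∈Γ}‖Y_s‖²`, AND THE TRUE-DERIVATIVE LINEARISATION OF THE (0.4) AVERAGE WITH THE
# `ℓ²`-ALONG-WALK HYPOTHESIS (`|Γ|·Σ_{s∈Γ}‖Y_s‖² ≤ m²` for every (0.4) walk at `c` ⇒ remainder `≤ 260m²`)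

Cell `ym3-torus` ∕ fleet seat `ym-ust-19200-p1` (gen 4).  Bookkeeping companion of `UnitScaleTiltProp7AvgTrueLinearisation` (p523393): the consumer of the `ℓ²`
route sums the remainder over the coarse bonds against `Σ_b‖Y_b‖²`, so the natural hypothesis is the `ℓ²` mass of `Y` along each (0.4) walk times its
length; Cauchy–Schwarz for lists converts it into the `ℓ¹` walk-mass hypothesis of p523393.  Sorry-free, no definition; nothing of Bałaban's is asserted.

References: T. Bałaban, CMP 98 (1985) 17–51 [Balaban1985Averaging] (Prop. 3 (122)–(124) p.36).
-/

noncomputable section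

open scoped BigOperators Matrix.Norms.L2Operator

namespace Summit.QuantumFields.YangMills.Theorems.Prop7HolRatioPerStep

open Literature.MathematicalPhysics.QuantumFieldTheory.Balaban1983to89
open T4Continuum BlockAveraging AveragingRT ExpMeanLog LatticeWordStokes B7TransferAnalyticMean BlockAveragingEMLAnalyticMean
open BlockAveragingEMLLinearised BlockAveragingEMLLinearisedBackground

/-- **CAUCHY–SCHWARZ FOR WALK MASSES**: `(Σ_{x∈l} a(x))² ≤ |l|·Σ_{x∈l} a(x)²`. [folklore] -/
theorem list_sq_sum_le_length_mul_sum_sq {ι : Type*} (a : ι → ℝ) :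
    ∀ l : List ι, (l.map a).sum ^ 2 ≤ (l.length : ℝ) * (l.map fun x => a x ^ 2).sum
  | [] => by simp
  | x :: l => by
    rw [List.map_cons, List.sum_cons, List.map_cons, List.sum_cons, List.length_cons]
    have ih := list_sq_sum_le_length_mul_sum_sq a l
    set S := (l.map a).sum with hS
    set T := (l.map fun x => a x ^ 2).sum with hT
    have hT0 : 0 ≤ T := List.sum_nonneg fun y hy => by obtain ⟨z, _, rfl⟩ := List.mem_map.mp hy; exact sq_nonneg _
    push_cast
    by_cases hl : l.length = 0
    · have hl' : l = [] := List.eq_nil_of_length_eq_zero hl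
      have hS0 : S = 0 := by rw [hS, hl']; simp
      have hT0' : T = 0 := by rw [hT, hl']; simp
      rw [hS0, hT0', hl]; push_cast; nlinarith [sq_nonneg (a x)]
    · have hl1 : (1 : ℝ) ≤ l.length := by exact_mod_cast Nat.one_le_iff_ne_zero.mpr hl
      -- `2aS ≤ |l|a² + T` from `|l|·(|l|a² + T − 2aS) ≥ (|l|a − S)² + (|l|T − S²) ≥ 0`
      have key : (l.length : ℝ) * ((l.length : ℝ) * a x ^ 2 + T - 2 * a x * S) ≥ 0 := by
        nlinarith [sq_nonneg ((l.length : ℝ) * a x - S), ih]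
      have h2 : 0 ≤ (l.length : ℝ) * a x ^ 2 + T - 2 * a x * S :=
        le_of_mul_le_mul_left (by rw [mul_zero]; exact key) (by linarith)
      nlinarith [h2, sq_nonneg (a x)]

variable {n : Type*} [Fintype n] [DecidableEq n] [Nonempty n] {P : Params} {j : ℕ}

omit [Nonempty n] in
/-- A walk mass is at most `m` when `|Γ|·Σ_{s∈Γ}‖Y_s‖² ≤ m²` (`m ≥ 0`). [folklore] -/
theorem walkMass_le_of_length_mul_sq_le (Y : PBond P j → Matrix n n ℂ) (γ : List (LStep P j)) {m : ℝ} (hm : 0 ≤ m)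
    (h : (γ.length : ℝ) * (γ.map fun s => ‖Y s.bond‖ ^ 2).sum ≤ m ^ 2) :
    (γ.map fun s => ‖Y s.bond‖).sum ≤ m := by
  have hcs := list_sq_sum_le_length_mul_sum_sq (fun s : LStep P j => ‖Y s.bond‖) γ
  have hS0 : 0 ≤ (γ.map fun s => ‖Y s.bond‖).sum := List.sum_nonneg fun y hy => by obtain ⟨z, _, rfl⟩ := List.mem_map.mp hy; exact norm_nonneg _
  have h2 : (γ.map fun s => ‖Y s.bond‖).sum ^ 2 ≤ m ^ 2 := hcs.trans h
  nlinarith [h2, hS0, hm]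

/-- **THE TRUE-DERIVATIVE LINEARISATION OF THE (0.4) AVERAGE, `ℓ²`-ALONG-WALK HYPOTHESES**: as `norm_avgFun_ratio_sub_one_sub_trueLin_le` (p523393) with the
walk-mass hypotheses replaced by `|Γ|·Σ_{s∈Γ}‖Y_s‖² ≤ m²` for every (0.4) loop walk at `c` and for the straight segment (`0 ≤ m`, `72m ≤ 1`): remainder `≤ 260m²`.
[cite: Balaban1985Averaging, Prop. 3 (122)-(124) p.36] -/
theorem norm_avgFun_ratio_sub_one_sub_trueLin_le_of_sq (U₀ U : GaugeField P j (Matrix.specialUnitaryGroup n ℂ)) (c : PBond P (j + 1)) {m α : ℝ} (hm : 0 ≤ m)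
    (hmL : ∀ i : Idx P, ((walk (emb c.src) (loopWord P.L c.dir (off i.1) i.2.1 i.2.2)).length : ℝ)
      * ((walk (emb c.src) (loopWord P.L c.dir (off i.1) i.2.1 i.2.2)).map fun s => ‖pertVar U₀ U s.bond‖ ^ 2).sum ≤ m ^ 2)
    (hmS : ((walk (emb c.src) (List.replicate P.L (c.dir, true))).length : ℝ)
      * ((walk (emb c.src) (List.replicate P.L (c.dir, true))).map fun s => ‖pertVar U₀ U s.bond‖ ^ 2).sum ≤ m ^ 2)
    (hm72 : 72 * m ≤ 1) (hα : ∀ i, dist1 (loopHol U₀ c i) ≤ α) (hα24 : α ≤ 1 / 24) (hN : 3 * m + α < deltaSU n) :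
    ‖((avgFun (expMeanLogSU (n := n)) U c : Matrix.specialUnitaryGroup n ℂ) : Matrix n n ℂ) *
          star ((avgFun (expMeanLogSU (n := n)) U₀ c : Matrix.specialUnitaryGroup n ℂ) : Matrix n n ℂ) - 1 -
        (fderiv ℂ (eml : (Idx P → Matrix n n ℂ) → Matrix n n ℂ) (fun i => ((loopHol U₀ c i : Matrix.specialUnitaryGroup n ℂ) : Matrix n n ℂ))
            (fun i => covWalkSum U₀ (pertVar U₀ U) (walk (emb c.src) (loopWord P.L c.dir (off i.1) i.2.1 i.2.2))
              * ((loopHol U₀ c i : Matrix.specialUnitaryGroup n ℂ) : Matrix n n ℂ))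
            * star ((corr (expMeanLogSU (n := n)) U₀ c : Matrix.specialUnitaryGroup n ℂ) : Matrix n n ℂ)
          + ((corr (expMeanLogSU (n := n)) U₀ c : Matrix.specialUnitaryGroup n ℂ) : Matrix n n ℂ)
            * covWalkSum U₀ (pertVar U₀ U) (walk (emb c.src) (List.replicate P.L (c.dir, true)))
            * star ((corr (expMeanLogSU (n := n)) U₀ c : Matrix.specialUnitaryGroup n ℂ) : Matrix n n ℂ))‖ ≤ 260 * m ^ 2 :=
  norm_avgFun_ratio_sub_one_sub_trueLin_le U₀ U c (fun i => walkMass_le_of_length_mul_sq_le _ _ hm (hmL i))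
    (walkMass_le_of_length_mul_sq_le _ _ hm hmS) hm72 hα hα24 hN

end Summit.QuantumFields.YangMills.Theorems.Prop7HolRatioPerStep

end
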